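import Literature.Geometry.Kaehler.MayerVietoris

/-!
# SmoothPoincare4 / SullivanDual — crux `Target` (stmt-SmoothPoincare4-7823), stub `helper_localClosedForms_succ_union_le_of_inter`

The Mayer–Vietoris vanishing criterion for the local de Rham cohomology of open subsets of a
manifold (`Literature.Geometry.Kaehler.LocalForms`): for open `P`, `Q`,

  `H^{k+1}(P) = 0`, `H^{k+1}(Q) = 0`, `H^k(P ∩ Q) = 0`  ⟹  `H^{k+1}(P ∪ Q) = 0`,

phrased as inclusions `localClosedForms ≤ localExactForms`.

Proof.  Let `θ` be a closed `(k+1)`-form on `P ∪ Q` and `c = [θ] ∈ H^{k+1}(P ∪ Q)`.  Its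
restrictions to `P` and to `Q` are the classes of `θ|_P`, `θ|_Q`, closed hence exact by
hypothesis, so `res_P c = res_Q c = 0`.  By exactness of the Mayer–Vietoris sequence at
`H^{k+1}(P ∪ Q)` (`LocalDeRham.exists_delta_eq_res` with `A = P`, `B = Q` and a bump pair from
`exists_bumpPair`), `c = res_{P ∪ Q} c = δ (res c')` for a class `c' ∈ H^k(P ∩ Q)`; but
`H^k(P ∩ Q) = 0`, so `c' = 0` and `c = 0`, i.e. `θ` is exact on `P ∪ Q`.

References: R. Bott, L. W. Tu, *Differential Forms in Algebraic Topology* (1982), §I.2,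
Prop. 2.3 [BottTu1982Forms].
-/

noncomputable section

-- the registered namespace `Summit.SmoothPoincare4.SmoothPoincare4.Theorems` repeats a component
set_option linter.dupNamespace false

open scoped Manifold ContDiff Topology
open Set Filter
open Literature.Geometry.Kaehler

namespace Summit.SmoothPoincare4.SmoothPoincare4.Theorems

namespace SullivanDual

/-- **Mayer–Vietoris vanishing criterion.**  For open subsets `P`, `Q` of a Hausdorff,
second-countable `C^∞` manifold on a finite-dimensional model: if every closed `(k+1)`-form on
`P` and on `Q` is exact and every closed `k`-form on `P ∩ Q` is exact, then every closed
`(k+1)`-form on `P ∪ Q` is exact (`H^{k+1}(P) = H^{k+1}(Q) = 0`, `H^k(P ∩ Q) = 0` imply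
`H^{k+1}(P ∪ Q) = 0`, by exactness of `H^k(P ∩ Q) → H^{k+1}(P ∪ Q) → H^{k+1}(P) ⊕ H^{k+1}(Q)`).
[cite: BottTu1982Forms, Prop. 2.3] -/
theorem helper_localClosedForms_succ_union_le_of_inter
    {E : Type*} [NormedAddCommGroup E] [NormedSpace ℝ E] [FiniteDimensional ℝ E]
    {H : Type*} [TopologicalSpace H] {I : ModelWithCorners ℝ E H}
    {M : Type*} [TopologicalSpace M] [ChartedSpace H M] [IsManifold I ∞ M] [T2Space M]
    [SecondCountableTopology M]
    {F : Type*} [NormedAddCommGroup F] [NormedSpace ℝ F]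
    {P Q : Set M} (hP : IsOpen P) (hQ : IsOpen Q) (k : ℕ)
    (hPe : localClosedForms I F (k + 1) P ≤ localExactForms I F hP (k + 1))
    (hQe : localClosedForms I F (k + 1) Q ≤ localExactForms I F hQ (k + 1))
    (hPQ : localClosedForms I F k (P ∩ Q) ≤ localExactForms I F (hP.inter hQ) k) :
    localClosedForms I F (k + 1) (P ∪ Q) ≤ localExactForms I F (hP.union hQ) (k + 1) := by
  intro θ hθ
  obtain ⟨b⟩ := exists_bumpPair (I := I) hP hQ
  -- the class of `θ` and the vanishing of its restrictions to `P` and to `Q`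
  set c : LocalDeRham I F (k + 1) (hP.union hQ) := LocalDeRham.mk (hP.union hQ) ⟨θ, hθ⟩ with hc
  have hcP : LocalDeRham.res I F (k + 1) hP (hP.union hQ) subset_union_left c = 0 := by
    rw [hc, LocalDeRham.res_mk, LocalDeRham.mk_eq_zero_iff, coe_restrictClosedₗ]
    exact hPe (restr_mem_localClosedForms hP subset_union_left hθ)
  have hcQ : LocalDeRham.res I F (k + 1) hQ (hP.union hQ) subset_union_right c = 0 := by
    rw [hc, LocalDeRham.res_mk, LocalDeRham.mk_eq_zero_iff, coe_restrictClosedₗ]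
    exact hQe (restr_mem_localClosedForms hQ subset_union_right hθ)
  -- Mayer–Vietoris: `c = δ (res c')` with `c' ∈ H^k(P ∩ Q) = 0`
  obtain ⟨c', hc'⟩ :=
    LocalDeRham.exists_delta_eq_res hP hQ hP hQ subset_rfl subset_rfl b hcP hcQ
  have hc'0 : c' = 0 := by
    obtain ⟨⟨γ, hγ⟩, rfl⟩ := LocalDeRham.mk_surjective _ c'
    rw [LocalDeRham.mk_eq_zero_iff]
    exact hPQ hγ
  rw [hc'0, map_zero, map_zero, LocalDeRham.res_self] at hc'
  rw [hc, LocalDeRham.mk_eq_zero_iff] at hc'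
  exact hc'

end SullivanDual

end Summit.SmoothPoincare4.SmoothPoincare4.Theorems

end
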